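import Mathlib.RingTheory.MvPolynomial.Homogeneous
import Literature.NumberTheory.Transcendental.ExpDominantSolvabilityAnalysis
import Summits.Schanuel.Schanuel.Theorems.ZilberEacComplexPunctureDecouplingLemmas
import HarnessLib

/-!
# Exponential points near lattice centres: the moving-polydisc perturbation theorem

Infrastructure for new cases of Zilber's Exponential-Algebraic Closedness for `ℂ_exp` in the
range `dim π₁(V) = n - 1` (the first open rung, Mantova–Masser, PLMS 129 (2024), §1 p. 5), beyond
the "negative leading real part" class of
`Summits/Schanuel/Schanuel/Theorems/ZilberEacComplexPunctureDecoupling.lean` /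
`…PunctureBM.lean`: there the smallness of the coupling term `e^{g(x)}` came from the leading form
of `g` along a lattice ray `2πi m q` on a ball of radius `ρ m`; for *oscillatory* bases
(`Re g_D(2πi q) = 0` for every `q ∈ ℤˢ`, e.g. `x₃ = x₁³ + x₂³`, `x₃ = i x₁ x₂`) one must instead
work on the unit polydisc around the *lattice centre*
`x₀(m) = (2πi m qⱼ + log Aⱼ(2πi m q))ⱼ`, whose real parts `log |Aⱼ(2πi m q)| ≈ (deg Aⱼ) log m`
are forced by the fibre. This file proves the abstract step:

* `eval_near_natMul_add` — leading-form asymptotics of a polynomial at `m v + η`, `‖η‖ ≤ ρ m`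
  (additive repackaging of `Literature.NumberTheory.Transcendental.ExpDominant.eval_smul_near_top`);
* `latticeValue_control` — two-sided bounds `‖A_d(v)‖/2 · m^d ≤ ‖A(m v)‖ ≤ 2 ‖A_d(v)‖ m^d` and the
  relative variation bound `‖A(m v + η) - A(m v)‖ ≤ κ ‖A(m v)‖` for `‖η‖ ≤ ρ m`;
* `log_latticeValue_bounds` — `d log m + log(‖A_d(v)‖/2) ≤ log ‖A(m v)‖ ≤ d log m + log (2‖A_d(v)‖)`
  and `‖log A(m v)‖ ≤ d log m + C`;
* `exists_exp_eq_poly_add_near_latticeCentre` — **the moving-polydisc perturbation theorem**: if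
  `Aⱼ ∈ ℂ[x₁..xₛ]` have leading forms not vanishing at `v = 2πi q` and the entire perturbations
  `Pⱼ` tend to `0` uniformly on the unit polydiscs around `x₀(m)`, then for all large `m` the system
  `exp xⱼ = Aⱼ(x) + Pⱼ(x)` has a solution with `‖x - x₀(m)‖ ≤ 1/2` (contraction lemma of the
  Brownawell–Masser / D'Aquino–Fornasiero–Terzo Newton argument,
  `Literature.NumberTheory.Transcendental.ExpDominant.exists_exp_eq_one_add`, via
  `exists_exp_eq_affine_add`).

HONEST FRAMING: infrastructure for modest new sub-rungs of EAC; nothing here bears on Schanuel's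
conjecture.
-/

noncomputable section

open Complex MvPolynomial Metric Set Filter Topology

set_option linter.dupNamespace false

namespace Summit.Schanuel.Schanuel.Theorems

/-! ### Polynomials near a lattice ray -/

/-- **Leading-form asymptotics at `m v + η`.** For `A ∈ ℂ[x₁..xₛ]` of total degree `d` with
leading form `A_d`, any `v` and `ε > 0` there are `ρ > 0`, `t₀ ≥ 1` with
`‖A(m v + η) - m^d A_d(v)‖ ≤ ε m^d` whenever `m ≥ t₀` and `‖η‖ ≤ ρ m` (additive form of
`Literature.NumberTheory.Transcendental.ExpDominant.eval_smul_near_top`, D'Aquino–Fornasiero–Terzo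
2018 Lemma 2.3). [cite: DaquinoFornasieroTerzo2017, Lemma 2.3] -/
theorem eval_near_natMul_add {s : ℕ} (A : MvPolynomial (Fin s) ℂ) (v : Fin s → ℂ) {ε : ℝ}
    (hε : 0 < ε) :
    ∃ ρ : ℝ, 0 < ρ ∧ ∃ t₀ : ℝ, 1 ≤ t₀ ∧ ∀ m : ℕ, t₀ ≤ (m : ℝ) → ∀ η : Fin s → ℂ,
      ‖η‖ ≤ ρ * m →
      ‖eval ((fun i => (m : ℂ) * v i) + η) A -
          (m : ℂ) ^ A.totalDegree * eval v (homogeneousComponent A.totalDegree A)‖ ≤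
        ε * (m : ℝ) ^ A.totalDegree := by
  obtain ⟨ρ, hρ, t₀, ht₀, h⟩ :=
    Literature.NumberTheory.Transcendental.ExpDominant.eval_smul_near_top A v hε
  refine ⟨ρ, hρ, t₀, ht₀, fun m hm η hη => ?_⟩
  have hm0 : (0 : ℝ) < m := by linarith
  have hmC : (m : ℂ) ≠ 0 := by exact_mod_cast hm0.ne'
  set ζ : Fin s → ℂ := (m : ℂ)⁻¹ • η with hζ
  have hx : (fun i => (m : ℂ) * v i) + η = ((m : ℝ) : ℂ) • (v + ζ) := by
    funext i
    simp only [hζ, Complex.ofReal_natCast, Pi.add_apply, Pi.smul_apply, smul_eq_mul]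
    field_simp
  have hζρ : ‖ζ‖ ≤ ρ := by
    rw [hζ, norm_smul, norm_inv, Complex.norm_natCast, inv_mul_le_iff₀ hm0, mul_comm]
    exact hη
  have := h m hm ζ hζρ
  rwa [← hx, Complex.ofReal_natCast] at this

/-- **Control of a polynomial at and near the lattice points `m v`.** If the leading form `A_d`
of `A` does not vanish at `v`, then for every `κ > 0` there are `ρ > 0`, `t₀ ≥ 1` such that for
all `m ≥ t₀`: `A(m v) ≠ 0`, `‖A_d(v)‖/2 · m^d ≤ ‖A(m v)‖ ≤ 2 ‖A_d(v)‖ m^d`, and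
`‖A(m v + η) - A(m v)‖ ≤ κ ‖A(m v)‖` for all `‖η‖ ≤ ρ m`. [folklore] -/
theorem latticeValue_control {s : ℕ} (A : MvPolynomial (Fin s) ℂ) (v : Fin s → ℂ)
    (hA : eval v (homogeneousComponent A.totalDegree A) ≠ 0) {κ : ℝ} (hκ : 0 < κ) :
    ∃ ρ : ℝ, 0 < ρ ∧ ∃ t₀ : ℝ, 1 ≤ t₀ ∧ ∀ m : ℕ, t₀ ≤ (m : ℝ) →
      eval (fun i => (m : ℂ) * v i) A ≠ 0 ∧
      ‖eval v (homogeneousComponent A.totalDegree A)‖ / 2 * (m : ℝ) ^ A.totalDegree ≤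
        ‖eval (fun i => (m : ℂ) * v i) A‖ ∧
      ‖eval (fun i => (m : ℂ) * v i) A‖ ≤
        2 * ‖eval v (homogeneousComponent A.totalDegree A)‖ * (m : ℝ) ^ A.totalDegree ∧
      ∀ η : Fin s → ℂ, ‖η‖ ≤ ρ * m →
        ‖eval ((fun i => (m : ℂ) * v i) + η) A - eval (fun i => (m : ℂ) * v i) A‖ ≤
          κ * ‖eval (fun i => (m : ℂ) * v i) A‖ := by
  set d := A.totalDegree with hd
  set a := eval v (homogeneousComponent d A) with ha
  have ha0 : 0 < ‖a‖ := norm_pos_iff.mpr hA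
  set ε : ℝ := min (‖a‖ / 2) (κ * ‖a‖ / 4) with hεdef
  have hε : 0 < ε := lt_min (by positivity) (by positivity)
  have hε1 : ε ≤ ‖a‖ / 2 := min_le_left _ _
  have hε2 : ε ≤ κ * ‖a‖ / 4 := min_le_right _ _
  obtain ⟨ρ, hρ, t₀, ht₀, h⟩ := eval_near_natMul_add A v hε
  refine ⟨ρ, hρ, t₀, ht₀, fun m hm => ?_⟩
  have hm0 : (0 : ℝ) < m := by linarith
  have hmd : (0 : ℝ) < (m : ℝ) ^ d := pow_pos hm0 d
  -- at the lattice point itself (`η = 0`)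
  have h0 := h m hm 0 (by rw [norm_zero]; positivity)
  rw [add_zero] at h0
  set α := eval (fun i => (m : ℂ) * v i) A with hα
  have hmain : ‖(m : ℂ) ^ d * a‖ = (m : ℝ) ^ d * ‖a‖ := by
    rw [norm_mul, norm_pow, Complex.norm_natCast]
  have hlow : ‖a‖ / 2 * (m : ℝ) ^ d ≤ ‖α‖ := by
    have h1 : ‖(m : ℂ) ^ d * a‖ - ‖α - (m : ℂ) ^ d * a‖ ≤ ‖α‖ := by
      have := norm_sub_norm_le ((m : ℂ) ^ d * a) α
      rw [norm_sub_rev] at this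
      linarith
    have h2 : ‖α - (m : ℂ) ^ d * a‖ ≤ ‖a‖ / 2 * (m : ℝ) ^ d :=
      h0.trans (mul_le_mul_of_nonneg_right hε1 hmd.le)
    rw [hmain] at h1
    nlinarith
  have hαpos : 0 < ‖α‖ := lt_of_lt_of_le (by positivity) hlow
  refine ⟨norm_pos_iff.mp hαpos, hlow, ?_, fun η hη => ?_⟩
  · have h1 : ‖α‖ ≤ ‖(m : ℂ) ^ d * a‖ + ‖α - (m : ℂ) ^ d * a‖ := by
      have := norm_add_le ((m : ℂ) ^ d * a) (α - (m : ℂ) ^ d * a)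
      rwa [add_sub_cancel] at this
    have h2 : ‖α - (m : ℂ) ^ d * a‖ ≤ ‖a‖ / 2 * (m : ℝ) ^ d :=
      h0.trans (mul_le_mul_of_nonneg_right hε1 hmd.le)
    rw [hmain] at h1
    nlinarith
  · have h1 := h m hm η hη
    calc ‖eval ((fun i => (m : ℂ) * v i) + η) A - α‖
        ≤ ‖eval ((fun i => (m : ℂ) * v i) + η) A - (m : ℂ) ^ d * a‖ +
            ‖α - (m : ℂ) ^ d * a‖ := by
          have := norm_sub_le (eval ((fun i => (m : ℂ) * v i) + η) A - (m : ℂ) ^ d * a)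
            (α - (m : ℂ) ^ d * a)
          rwa [sub_sub_sub_cancel_right] at this
      _ ≤ ε * (m : ℝ) ^ d + ε * (m : ℝ) ^ d := add_le_add h1 h0
      _ ≤ κ * ‖a‖ / 4 * (m : ℝ) ^ d + κ * ‖a‖ / 4 * (m : ℝ) ^ d := by gcongr
      _ = κ * (‖a‖ / 2 * (m : ℝ) ^ d) := by ring
      _ ≤ κ * ‖α‖ := mul_le_mul_of_nonneg_left hlow hκ.le

/-- `‖log z‖ ≤ |log ‖z‖| + π` for every `z` (real part `log ‖z‖`, imaginary part `arg z`).
[folklore] -/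
theorem norm_log_le_abs_log_norm_add_pi (z : ℂ) :
    ‖log z‖ ≤ |Real.log ‖z‖| + Real.pi := by
  have h1 : ‖log z‖ ≤ |(log z).re| + |(log z).im| := Complex.norm_le_abs_re_add_abs_im _
  rw [Complex.log_re, Complex.log_im] at h1
  have h3 : |arg z| ≤ Real.pi := Complex.abs_arg_le_pi z
  linarith

/-- **Logarithms of the lattice values.** If `c₁ m^d ≤ ‖α‖ ≤ c₂ m^d` with `0 < c₁` and `1 ≤ m`,
then `d log m + log c₁ ≤ log ‖α‖ ≤ d log m + log c₂` and
`‖log α‖ ≤ d log m + (|log c₁| + |log c₂| + π)`. [folklore] -/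
theorem log_latticeValue_bounds {α : ℂ} {c₁ c₂ m : ℝ} {d : ℕ} (hc₁ : 0 < c₁) (hm : 1 ≤ m)
    (hlow : c₁ * m ^ d ≤ ‖α‖) (hupp : ‖α‖ ≤ c₂ * m ^ d) :
    d * Real.log m + Real.log c₁ ≤ Real.log ‖α‖ ∧
      Real.log ‖α‖ ≤ d * Real.log m + Real.log c₂ ∧
      ‖log α‖ ≤ d * Real.log m + (|Real.log c₁| + |Real.log c₂| + Real.pi) := by
  have hm0 : 0 < m := by linarith
  have hmd : 0 < m ^ d := pow_pos hm0 d
  have hα : 0 < ‖α‖ := lt_of_lt_of_le (by positivity) hlow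
  have hc₂ : 0 < c₂ := by
    by_contra h
    have h' : c₂ ≤ 0 := not_lt.mp h
    have : c₂ * m ^ d ≤ 0 := mul_nonpos_of_nonpos_of_nonneg h' hmd.le
    linarith
  have hlogm : 0 ≤ Real.log m := Real.log_nonneg hm
  have h1 : d * Real.log m + Real.log c₁ ≤ Real.log ‖α‖ := by
    have := Real.log_le_log (by positivity) hlow
    rwa [Real.log_mul hc₁.ne' hmd.ne', Real.log_pow, add_comm] at this
  have h2 : Real.log ‖α‖ ≤ d * Real.log m + Real.log c₂ := by
    have := Real.log_le_log hα hupp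
    rwa [Real.log_mul hc₂.ne' hmd.ne', Real.log_pow, add_comm] at this
  refine ⟨h1, h2, (norm_log_le_abs_log_norm_add_pi α).trans ?_⟩
  have h3 : |Real.log ‖α‖| ≤ d * Real.log m + (|Real.log c₁| + |Real.log c₂|) := by
    rw [abs_le]
    constructor
    · have : -|Real.log c₁| ≤ Real.log c₁ := neg_abs_le _
      have : 0 ≤ |Real.log c₂| := abs_nonneg _
      nlinarith
    · have : Real.log c₂ ≤ |Real.log c₂| := le_abs_self _
      have : 0 ≤ |Real.log c₁| := abs_nonneg _
      nlinarith
  linarith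

/-- `(a log r + b) / r → 0` as `r → ∞`. [folklore] -/
theorem tendsto_mul_log_add_div_atTop (a b : ℝ) :
    Tendsto (fun r : ℝ => (a * Real.log r + b) / r) atTop (𝓝 0) := by
  have h1 : Tendsto (fun r : ℝ => Real.log r / r) atTop (𝓝 0) :=
    Real.isLittleO_log_id_atTop.tendsto_div_nhds_zero
  have h2 : Tendsto (fun r : ℝ => b / r) atTop (𝓝 0) := tendsto_const_nhds.div_atTop tendsto_id
  have h3 := (h1.const_mul a).add h2
  rw [mul_zero, zero_add] at h3
  refine h3.congr' (Eventually.of_forall fun r => ?_)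
  simp only
  ring

/-- Eventual form: for `δ > 0`, `a log m + b ≤ δ m` for all large `m ∈ ℕ`. [folklore] -/
theorem eventually_mul_log_add_le (a b : ℝ) {δ : ℝ} (hδ : 0 < δ) :
    ∀ᶠ m : ℕ in atTop, a * Real.log m + b ≤ δ * m := by
  have h1 := ((tendsto_mul_log_add_div_atTop a b).comp tendsto_natCast_atTop_atTop).eventually
    (eventually_le_nhds hδ)
  filter_upwards [h1, eventually_ge_atTop 1] with m hm hm1
  have hm' : (0 : ℝ) < m := by exact_mod_cast hm1
  have := (div_le_iff₀ hm').mp hm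
  simpa using this

/-! ### The moving-polydisc perturbation theorem -/

/-- **Moving-polydisc perturbation theorem.** Let `q ∈ ℤˢ`, `v = 2πi q`, and let
`A₁, …, Aₛ ∈ ℂ[x₁..xₛ]` have leading forms with `(Aⱼ)_{dⱼ}(v) ≠ 0` (`dⱼ = deg Aⱼ`; for constant
`Aⱼ` this says `Aⱼ ≠ 0`). Put `αⱼ(m) = Aⱼ(m v)` and let `x₀(m) = (m vⱼ + log αⱼ(m))ⱼ` be the
*lattice centre* (`exp x₀(m)ⱼ = αⱼ(m)`, `Re x₀(m)ⱼ = log |αⱼ(m)| = dⱼ log m + O(1)`). Let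
`Pⱼ : ℂˢ → ℂ` be entire and assume `Pⱼ → 0` uniformly on the unit polydiscs around `x₀(m)`:
for every `θ > 0`, `‖Pⱼ(x₀(m) + ξ)‖ ≤ θ` for all `‖ξ‖ ≤ 1` and all large `m`. Then for all large
`m` the system `exp xⱼ = Aⱼ(x) + Pⱼ(x)` (`j ≤ s`) has a solution `x` with `‖x - x₀(m)‖ ≤ 1/2`.
Proof: `Aⱼ(x₀(m) + ξ) = αⱼ(m)(1 + O(log m / m))` by the leading-form asymptotics
(`latticeValue_control`), so the system is `exp(ξⱼ) = 1 + (small holomorphic)`, solved by the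
contraction lemma `exists_exp_eq_affine_add` (D'Aquino–Fornasiero–Terzo 2018 Lemma 2.2 /
Brownawell–Masser 2017). New in this form (the abstract step behind the oscillatory-base cases of
Exponential-Algebraic Closedness in `ZilberEacComplexOscillatoryBase.lean`).
[cite: DaquinoFornasieroTerzo2017, Lemma 2.2 (contraction step)] -/
theorem exists_exp_eq_poly_add_near_latticeCentre {s : ℕ} (q : Fin s → ℤ)
    (A : Fin s → MvPolynomial (Fin s) ℂ)
    (hA : ∀ j, eval (fun i => 2 * Real.pi * I * (q i : ℂ))
      (homogeneousComponent (A j).totalDegree (A j)) ≠ 0)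
    (P : Fin s → (Fin s → ℂ) → ℂ) (hP : ∀ j, Differentiable ℂ (P j))
    (hPsmall : ∀ j, ∀ θ : ℝ, 0 < θ → ∀ᶠ m : ℕ in atTop, ∀ ξ : Fin s → ℂ, ‖ξ‖ ≤ 1 →
      ‖P j ((fun i => (m : ℂ) * (2 * Real.pi * I * (q i : ℂ)) +
          log (eval (fun k => (m : ℂ) * (2 * Real.pi * I * (q k : ℂ))) (A i))) + ξ)‖ ≤ θ) :
    ∀ᶠ m : ℕ in atTop, ∃ x : Fin s → ℂ,
      ‖x - fun i => (m : ℂ) * (2 * Real.pi * I * (q i : ℂ)) +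
          log (eval (fun k => (m : ℂ) * (2 * Real.pi * I * (q k : ℂ))) (A i))‖ ≤ 1 / 2 ∧
      ∀ j, exp (x j) = eval x (A j) + P j x := by
  classical
  set v : Fin s → ℂ := fun j => 2 * Real.pi * I * (q j : ℂ) with hv
  set w : ℕ → Fin s → ℂ := fun m j => (m : ℂ) * v j with hw
  set α : ℕ → Fin s → ℂ := fun m j => eval (w m) (A j) with hαdef
  set x₀ : ℕ → Fin s → ℂ := fun m j => w m j + log (α m j) with hx₀
  have hκ : (0 : ℝ) < 1 / (64 * (s + 1)) := by positivity
  have hctrl := fun j => latticeValue_control (A j) v (hA j) hκ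
  choose ρ hρ t₀ ht₀ hc using hctrl
  -- the norms of the leading coefficients
  set a : Fin s → ℝ := fun j => ‖eval v (homogeneousComponent (A j).totalDegree (A j))‖ with ha
  have ha0 : ∀ j, 0 < a j := fun j => norm_pos_iff.mpr (hA j)
  -- ### eventual facts
  -- (1) `m ≥ t₀ j` for all `j`
  have hev1 : ∀ᶠ m : ℕ in atTop, ∀ j, t₀ j ≤ (m : ℝ) :=
    eventually_all.2 fun j => tendsto_natCast_atTop_atTop.eventually_ge_atTop (t₀ j)
  -- (2) `‖log (α m i)‖ ≤ δ m` for every `δ > 0`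
  have hev2 : ∀ δ : ℝ, 0 < δ → ∀ᶠ m : ℕ in atTop, ∀ i, ‖log (α m i)‖ ≤ δ * m := by
    intro δ hδ
    refine eventually_all.2 fun i => ?_
    have h1 : ∀ᶠ m : ℕ in atTop, t₀ i ≤ (m : ℝ) :=
      tendsto_natCast_atTop_atTop.eventually_ge_atTop (t₀ i)
    filter_upwards [h1, eventually_mul_log_add_le ((A i).totalDegree : ℝ)
      (|Real.log (a i / 2)| + |Real.log (2 * a i)| + Real.pi) hδ] with m hm hm2
    obtain ⟨-, hlow, hupp, -⟩ := hc i m hm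
    have hm1 : (1 : ℝ) ≤ m := (ht₀ i).trans hm
    exact (log_latticeValue_bounds (by have := ha0 i; positivity) hm1 hlow hupp).2.2.trans hm2
  -- (3) `‖log (α m)‖ + 1 ≤ ρ j * m` for all `j`
  have hev3 : ∀ᶠ m : ℕ in atTop, ∀ j, ‖fun i => log (α m i)‖ + 1 ≤ ρ j * m := by
    refine eventually_all.2 fun j => ?_
    filter_upwards [hev2 (ρ j / 2) (half_pos (hρ j)),
      (tendsto_natCast_atTop_atTop.const_mul_atTop (half_pos (hρ j))).eventually_ge_atTop 1]
      with m hm hm'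
    have : ‖fun i => log (α m i)‖ ≤ ρ j / 2 * m :=
      (pi_norm_le_iff_of_nonneg (by have := hρ j; positivity)).2 fun i => hm i
    linarith
  -- (4) smallness of the perturbations
  have hev4 : ∀ᶠ m : ℕ in atTop, ∀ j, ∀ ξ : Fin s → ℂ, ‖ξ‖ ≤ 1 →
      ‖P j (x₀ m + ξ)‖ ≤ a j / 2 / (64 * (s + 1)) :=
    eventually_all.2 fun j => hPsmall j _ (by have := ha0 j; positivity)
  -- ### fix `m`
  filter_upwards [hev1, hev3, hev4] with m hm1 hm3 hm4
  have hfacts := fun j => hc j m (hm1 j)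
  have hm1' : ∀ j, (1 : ℝ) ≤ m := fun j => (ht₀ j).trans (hm1 j)
  have hexpw : ∀ j, exp (w m j) = 1 := fun j => exp_natCast_mul_twoPiI_mul_intCast m (q j)
  have hα0 : ∀ j, α m j ≠ 0 := fun j => (hfacts j).1
  have hexpx₀ : ∀ j, exp (x₀ m j) = α m j := by
    intro j
    show exp (w m j + log (α m j)) = α m j
    rw [Complex.exp_add, hexpw j, one_mul, Complex.exp_log (hα0 j)]
  -- lower bound `a j / 2 ≤ ‖α m j‖`
  have hαlow : ∀ j, a j / 2 ≤ ‖α m j‖ := by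
    intro j
    have h := (hfacts j).2.1
    have hmd : (1 : ℝ) ≤ (m : ℝ) ^ (A j).totalDegree := one_le_pow₀ (hm1' j)
    have := ha0 j
    nlinarith
  -- the total perturbation
  set Pt : Fin s → (Fin s → ℂ) → ℂ := fun j x => (eval x (A j) - α m j) + P j x with hPt
  have hPtdiff : ∀ j, Differentiable ℂ (Pt j) := fun j =>
    ((differentiable_mvPolynomial_eval (A j)).sub_const _).add (hP j)
  have hPtb : ∀ j, ∀ ξ : Fin s → ℂ, ‖ξ‖ < 1 → ‖Pt j (x₀ m + ξ)‖ ≤ ‖α m j‖ / (32 * (s + 1)) := by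
    intro j ξ hξ
    have hη : ‖(fun i => log (α m i)) + ξ‖ ≤ ρ j * m := by
      refine (norm_add_le _ _).trans ?_
      have := hm3 j
      linarith [hξ.le]
    have hsplit : x₀ m + ξ = w m + ((fun i => log (α m i)) + ξ) := by
      funext i; simp only [hx₀, Pi.add_apply]; ring
    have h1 : ‖eval (x₀ m + ξ) (A j) - α m j‖ ≤ 1 / (64 * (s + 1)) * ‖α m j‖ := by
      rw [hsplit]
      exact (hfacts j).2.2.2 _ hη
    have h2 : ‖P j (x₀ m + ξ)‖ ≤ 1 / (64 * (s + 1)) * ‖α m j‖ := by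
      refine (hm4 j ξ hξ.le).trans ?_
      have h3 : a j / 2 / (64 * (s + 1)) ≤ ‖α m j‖ / (64 * (s + 1)) :=
        div_le_div_of_nonneg_right (hαlow j) (by positivity)
      refine h3.trans_eq ?_
      ring
    calc ‖Pt j (x₀ m + ξ)‖ ≤ ‖eval (x₀ m + ξ) (A j) - α m j‖ + ‖P j (x₀ m + ξ)‖ := norm_add_le _ _
      _ ≤ 1 / (64 * (s + 1)) * ‖α m j‖ + 1 / (64 * (s + 1)) * ‖α m j‖ := add_le_add h1 h2
      _ = ‖α m j‖ / (32 * (s + 1)) := by field_simp; ring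
  -- ### the contraction step (with zero affine part)
  obtain ⟨ξ, hξ, hsol⟩ := exists_exp_eq_affine_add (x₀ m) 0 0 (α m) Pt hexpx₀ hα0 hPtdiff
    (fun j => by simp only [Pi.zero_apply, norm_zero, zero_mul]; positivity) hPtb
  refine ⟨x₀ m + ξ, ?_, fun j => ?_⟩
  · show ‖x₀ m + ξ - x₀ m‖ ≤ 1 / 2
    rwa [add_sub_cancel_left]
  · have h := hsol j
    simp only [Pi.add_apply, Pi.zero_apply, zero_mul, add_zero] at h ⊢
    rw [h, hPt]
    ring

end Summit.Schanuel.Schanuel.Theorems
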